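import Summits.ABC.IUTFork.LDHGenuinePerImageSharpRat
import Summits.ABC.IUTFork.LDHGenuinePerImageSufficiencyShell
import Literature.IUT.LogVolume.GenuineRamificationBounds
import Literature.IUT.LogVolume.CompletionLocalFieldsUnramified
import HarnessLib

/-!
# The fork at [IUTchIII] Corollary 3.12, L-DH level, READING (P): the datum-level sufficiency with the WILD LOG-SHELL term and the
# ramification weights at every place over a pole (abc-iut cell, crux ThetaPartII = stmt-ABC-19678; row «C:PERIMAGE-SHELL», part 2)

Record-only PROOF file (D-0012) of the abc-iut cell (WAVE-3 discharge seat abc-iut-c312-d1, gen 9). TAKES NO SIDE on [IUTchIII]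
Cor. 3.12. Part 1 (`LDHGenuinePerImageSufficiencyShell`) proved, at every genuine input, that the per-image `−|log(Θ)|` exceeds
`−deĝ̲_lgp(P_Θ) + ((ℓ⋇+3)/2 − [F₀:ℚ])·log(𝔡^K)` by the weighted eccentricity `Σ_p ((ℓ⋇+3)/2)·Σ_{u∣p} Pr(u)·S_p(u)` of the log-shells
`log_p(𝒪^×_{K_{u̲}})` for any shell function dominated by shell pairs (`TensorPacketContentShell`). HERE, at a `ℚ`-RATIONAL point with
`j(q) = N/∏_{p∈I} p^{e_p}`, the shell function is made EXPLICIT: at a pole `p ∉ {2, l}` of `j` with `l ∤ p − 1`, every completion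
`K_{u̲}` of the datum's `K` has ramification index `e ≥ m_p := l·lcm(30/gcd(30,e_p), c_p)` (part 2 of «C:PERIMAGE-DIFFSHARP»,
`LDHGenuinePerImageRamificationRat`; `e(K_{u̲}) = e(u̲ ∣ p)`, abc-iut-w5-d194's `PlaceSection.absRamificationIdx_localFieldFamily_eq`),
divisible by `l`, hence NOT a cyclotomic index `p^a(p−1)` (`l ≠ p`, `l ∤ p − 1`); so by `exists_shellPair_ge_of_forall_ne` the shell
function `S_p = (a − p^a/m_p)·log p` is admissible for EVERY `a : ℕ`. Consequently:

* `ThetaVolumeDatumAt.cor312PerImageOf_of_le_weighted_shell` — the datum-level sufficiency of part 3 of «C:PERIMAGE-DIFFSHARP»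
  (`cor312PerImageOf_of_le_weighted`) with the shell sum added to the right-hand side (any point `P`);
* `ThetaVolumeDatumAt.weight_dvd_ramificationIdx_int_of_mem` — `l·lcm(30/gcd(30,e_p), c_p) ∣ e(W ∣ p)` for EVERY place `W` of the
  datum's `K` over a pole `p ∉ {2, l}` (rational point);
* the closed-form rational-point test `Cor22.cor312PerImageOf_ratPoint_shell` is the sequel `LDHGenuinePerImageShellRat`.

Nothing here
asserts the existence of Θ-data, Cor. 3.12 in general or in print's reading, or abc; (Ind2)/the hull are the tree's typings
(reading (P), FULL lattice-automorphism (Ind2)); proved-as-typed ≠ in print. [cite: Mochizuki2012, IUTchI Def. 3.1 (a)(b)(c) p. 61–62;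
IUTchIII Cor. 3.12 p. 173–174, proof Step (x) p. 181; IUTchIV Prop. 1.2 (i)(ii) p. 10, Thm. 1.10 Step (ii) p. 24, Step (v) p. 27–29]
[cite: DupuyHilado2025, §4.9, §4.12] [cite: NeukirchANT1999, Ch. II (5.5), (6.8)] [claim: Mochizuki2012, status: disputed] for every IUT quotation.
PROOF-ONLY: no definitions, no new `Prop`.
-/

noncomputable section

open NumberField IsDedekindDomain Ideal Module

namespace Literature.IUT.LogVolume.Cor22

open Literature.NumberTheory.DiophantineGeometry.GenEll Summit.ABC.IUTFork Literature.IUT.HodgeTheaters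
open Literature.NumberTheory.NumberFields Literature.NumberTheory.GaloisRepresentations.Ultrametric
open Literature.NumberTheory.DiophantineGeometry.UniformABCConjecture Rat.HeightOneSpectrum

namespace ThetaVolumeDatumAt

/-! ## 1. The datum-level weighted sufficiency with the shell sum (any point) -/

variable {P : NFPoint} {l : ℕ} (T : ThetaVolumeDatumAt P l)

/-- **THE WEIGHTED SUFFICIENT HALF OF THE (P)-LINE CRUX WITH THE SHELL TERM**: as `cor312PerImageOf_of_le_weighted`, with a shell
function `S` on the places of `F_mod = F₀` of the datum's input dominated by shell pairs of the completions (hypothesis `hS`), and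
`Σ_{p∈T(I)} ((l+5)/4)·Σ_{u∣p} Pr(u)·S_p(u)` added to the right-hand side (part 1's `cor312PerImageOf_of_le_mul_ndeg_add_shell`).
[cite: Mochizuki2012, IUTchIII Cor. 3.12 p. 173–174] [cite: Mochizuki2012, IUTchIV Thm. 1.10 Step (ii) p. 24, Step (v) p. 27–29]
[claim: Mochizuki2012, status: disputed] -/
theorem cor312PerImageOf_of_le_weighted_shell (hU : P.InU) (hd : (dmod P : ℝ) ≤ ((l : ℝ) + 5) / 4)
    (Sx : Finset (HeightOneSpectrum (𝓞 P.F))) (m : HeightOneSpectrum (𝓞 P.F) → ℕ) (hm : ∀ v ∈ Sx, 0 < m v)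
    (hram : letI := T.instFieldF; letI := T.instNumberFieldF; letI := T.instAlgebraF; letI := T.instFieldK
      letI := T.instNumberFieldK; letI := T.instAlgebraK
      letI : Algebra P.F T.K := ((algebraMap T.F T.K).comp (algebraMap P.F T.F)).toAlgebra
      ∀ v ∈ Sx, ∀ w ∈ IsDedekindDomain.primesOverFinset v.asIdeal (𝓞 T.K), m v ≤ ramificationIdx' v.asIdeal w)
    (S : letI := T.instFieldF; letI := T.instNumberFieldF; letI := T.instIsElliptic
      (p : ℕ) → placesOver (fieldOfModuli T.E) p → ℝ)
    (hS : letI := T.instFieldF; letI := T.instNumberFieldF; letI := T.instAlgebraF; letI := T.instFieldK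
      letI := T.instNumberFieldK; letI := T.instAlgebraK; letI := T.instIsElliptic
      ∀ (p : ℕ) [hp : Fact p.Prime] (u : placesOver (fieldOfModuli T.E) p),
        ∃ c z : (T.I.σ.localFieldFamily p hp.out).k u,
          c ≠ 0 ∧ (∀ o : (T.I.σ.localFieldFamily p hp.out).k u, ‖o‖ ≤ 1 → c * o ∈ logUnits _) ∧
          (∃ (ϖ : ((T.I.σ.localFieldFamily p hp.out).k u)ˣ) (w : (T.I.σ.localFieldFamily p hp.out).k u),
            IsUniformizer ϖ ∧ w ∉ logUnits _ ∧ ‖w‖ * ‖(ϖ : (T.I.σ.localFieldFamily p hp.out).k u)‖ ≤ ‖c‖) ∧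
          z ≠ 0 ∧ z ∈ logUnits _ ∧ S p u ≤ Real.log ‖z‖ - Real.log ‖c‖)
    (h : letI := T.instFieldF; letI := T.instNumberFieldF; letI := T.instFieldK; letI := T.instNumberFieldK
      letI := T.instAlgebraK; letI := T.instIsElliptic
      (((l : ℝ) + 1) / 24 - 1 / (2 * l)) * logQAvoid P {2, l} ≤
      (((l : ℝ) + 5) / 4 - dmod P) * (P.logDiff
          + (P.degree : ℝ)⁻¹ * ∑ v ∈ Sx, (1 - (m v : ℝ)⁻¹) * Real.log (absNorm v.asIdeal : ℝ))
        + ∑ p ∈ T.I.supportPrimes, (((l : ℝ) + 5) / 4) *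
            ∑ u : placesOver (fieldOfModuli T.E) p, weight (fieldOfModuli T.E) u.1 * S p u
        + ThetaVolumeInput.archLogTheta l) :
    T.Cor312PerImageOf := by
  letI := T.instFieldF; letI := T.instNumberFieldF; letI := T.instAlgebraF; letI := T.instFieldK
  letI := T.instNumberFieldK; letI := T.instAlgebraK; letI := T.instFieldFbar; letI := T.instAlgebraFbar
  letI := T.instAlgebraKFbar; letI := T.instIsElliptic
  haveI := T.isGalois_fieldOfModuli_K
  have hgap := PointDict.gap_eq T hU
  have hXlN : T.I.X.l = l := T.isVolumeInputOf.l_eq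
  have hXl : ((T.I.X.l : ℕ) : ℝ) = (l : ℝ) := by exact_mod_cast hXlN
  have hls : ((T.I.X.lstar : ℝ) + 3) / 2 = ((l : ℝ) + 5) / 4 := by
    have h2 : T.I.X.l = 2 * T.I.X.lstar + 1 := T.I.X.l_eq
    have h2R : ((T.I.X.l : ℕ) : ℝ) = 2 * (T.I.X.lstar : ℝ) + 1 := by exact_mod_cast h2
    rw [hXl] at h2R
    linarith
  have hdm : (Module.finrank ℚ (fieldOfModuli T.E) : ℝ) = (dmod P : ℝ) := by
    exact_mod_cast PointStepV.finrank_fieldOfModuli_eq_dmod T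
  have hdiff := T.ndeg_differentDivisor_ge_weighted Sx m hm hram
  have hc : 0 ≤ ((l : ℝ) + 5) / 4 - (dmod P : ℝ) := by linarith
  have hmono := mul_le_mul_of_nonneg_left hdiff hc
  show T.I.Cor312PerImageOf
  refine GenuineContent.cor312PerImageOf_of_le_mul_ndeg_add_shell T.I S hS ?_
  rw [hXl, hls, hdm]
  have hg : T.gap = (((l : ℝ) + 1) / 24 - 1 / (2 * l)) * FinDivisor.ndeg (fieldOfModuli T.E) T.I.X.qDivisor := by
    show LgpDivisor.ndegLgp T.I.X.thetaPilot - FinDivisor.ndeg _ T.I.X.qPilot = _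
    rw [DHData.ndegLgp_thetaPilot_eq, PilotData.qPilot_eq_smul, map_smul, smul_eq_mul, hXl]
    ring
  rw [← hg, hgap]
  show _ ≤ _ + ThetaVolumeInput.archLogTheta T.I.X.l
  rw [hXlN]
  change P.logDiff + (P.degree : ℝ)⁻¹ * ∑ v ∈ Sx, (1 - (m v : ℝ)⁻¹) * Real.log (absNorm v.asIdeal : ℝ)
    ≤ ndeg T.K (differentDivisor T.K) at hdiff
  linarith

end ThetaVolumeDatumAt

/-! ## 2. At a rational point: the weight divides `e(W ∣ p)` at EVERY place `W` of `K` over a pole `p ∉ {2, l}` -/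

namespace ThetaVolumeDatumAt

variable {q : ℚ} {l : ℕ} (T : ThetaVolumeDatumAt (ratPoint q) l) {N D : ℕ} {I : Finset ℕ} {e : ℕ → ℕ}

/-- `e(v ∣ p) = 1` for a place `v` of a number field of degree `1` over `ℚ`. [folklore] -/
private theorem ramIdx_eq_one_of_finrank_eq_one' {F₀ : Type} [Field F₀] [NumberField F₀]
    (hF₀ : Module.finrank ℚ F₀ = 1) (v : HeightOneSpectrum (𝓞 F₀)) : ramIdx F₀ v = 1 := by
  haveI : (v.asIdeal.under ℤ).IsMaximal := Ideal.IsMaximal.under ℤ v.asIdeal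
  have h0 : v.asIdeal.under ℤ ≠ ⊥ := mt Ideal.eq_bot_of_comap_eq_bot v.ne_bot
  have hle : v.asIdeal.ramificationIdx ℤ ≤ Module.finrank ℚ F₀ := by
    rw [← Ideal.ramificationIdx'_eq_ramificationIdx (v.asIdeal.under ℤ) v.asIdeal h0]
    exact Ideal.ramificationIdx_le_finrank (𝓞 F₀) ℚ F₀ v.asIdeal (p := v.asIdeal.under ℤ)
  rw [hF₀, ← ramIdx_eq] at hle
  have hne : ramIdx F₀ v ≠ 0 := ramIdx_ne_zero F₀ v
  omega

/-- **`l·lcm(30/gcd(30,e_p), c_p) ∣ e(W ∣ p)`** for EVERY finite place `W` of the datum's `K` over a pole `p ∈ I ∖ {2, l}` of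
`j(q) = N/∏_{p∈I} p^{e_p}` (`c_3 = 2`, `c_5 = 4`, else `1`): `l ∣ e(W ∣ v_p)` ([IUTchI] Def. 3.1 (c) + Ex. 3.2 (iv), (P5)), the `30`-th Tate
root and `μ₃₀ ⊂ F` on the place of `F` under `W` (part 2 of «C:PERIMAGE-DIFFSHARP»), `l` prime to `lcm(…) ∣ 60`, and `e(W ∣ v_p) =
e(W ∣ p)` over `ℚ`. [cite: Mochizuki2012, IUTchI Def. 3.1 (c) p. 62, Ex. 3.2 (iv) p. 71; IUTchIV Thm. 1.10 p. 22] [cite: SilvermanATAEC1994, V.5 Thm. 5.3]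
[claim: Mochizuki2012, status: disputed] -/
theorem weight_dvd_ramificationIdx_int_of_mem (hl : l.Prime) (h7 : 7 ≤ l) (hI : ∀ p ∈ I, p.Prime) (he : ∀ p ∈ I, e p ≠ 0)
    (hD : D = ∏ p ∈ I, p ^ e p) (hj : jInv q = (N : ℚ) / (D : ℚ)) (hN : N ≠ 0) (hcop : ∀ p ∈ I, ¬ p ∣ N)
    {p : ℕ} (hpI : p ∈ I) (hp2 : p ≠ 2) (hpl : p ≠ l)
    (W : letI := T.instFieldK; letI := T.instNumberFieldK; HeightOneSpectrum (𝓞 T.K))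
    (hW : letI := T.instFieldK; letI := T.instNumberFieldK; ((p : ℕ) : 𝓞 T.K) ∈ W.asIdeal) :
    l * Nat.lcm (30 / Nat.gcd 30 (e p)) (if p = 3 then 2 else if p = 5 then 4 else 1) ∣
      (letI := T.instFieldK; letI := T.instNumberFieldK; W.asIdeal.ramificationIdx ℤ) := by
  classical
  letI := T.instFieldF; letI := T.instNumberFieldF; letI := T.instAlgebraF; letI := T.instFieldK
  letI := T.instNumberFieldK; letI := T.instAlgebraK
  letI : Algebra (ratPoint q).F T.K := ((algebraMap T.F T.K).comp (algebraMap (ratPoint q).F T.F)).toAlgebra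
  haveI : IsScalarTower (ratPoint q).F T.F T.K := IsScalarTower.of_algebraMap_eq fun _ => rfl
  have hl2 : l ≠ 2 := by omega
  have hl3 : l ≠ 3 := by omega
  have hl5 : l ≠ 5 := by omega
  have hpp := hI p hpI
  -- the place of `ℚ` under `W`
  set v : HeightOneSpectrum (𝓞 (ratPoint q).F) := W.under (𝓞 (ratPoint q).F) with hv
  have hWmem : W.asIdeal ∈ IsDedekindDomain.primesOverFinset v.asIdeal (𝓞 T.K) := by
    rw [IsDedekindDomain.mem_primesOverFinset_iff v.ne_bot]
    exact ⟨W.isPrime, ⟨rfl⟩⟩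
  have hpv : ((p : ℕ) : 𝓞 (ratPoint q).F) ∈ v.asIdeal := by
    change ((p : ℕ) : 𝓞 (ratPoint q).F) ∈ W.asIdeal.comap (algebraMap (𝓞 (ratPoint q).F) (𝓞 T.K))
    rw [Ideal.mem_comap, map_natCast]
    exact hW
  -- `e(W ∣ p) = e(W ∣ v)`
  have habs : W.asIdeal.ramificationIdx ℤ = ramificationIdx' v.asIdeal W.asIdeal := by
    have h := ThetaData.absRamificationIdx_eq_ramIdx_mul (F := (ratPoint q).F) W
    rw [ramIdx_eq_one_of_finrank_eq_one' (degree_ratPoint q), one_mul] at h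
    exact h
  rw [habs]
  -- `v` is the place of the prime `p`, a pole of `j(q)` away from `2l`
  have hf : v = (primesEquiv (R := 𝓞 ℚ)).symm ⟨p, hpp⟩ := by
    apply natGenerator_injective
    have h1 : natGenerator (R := 𝓞 ℚ) ((primesEquiv (R := 𝓞 ℚ)).symm ⟨p, hpp⟩) = p :=
      congrArg Subtype.val ((primesEquiv (R := 𝓞 ℚ)).apply_symm_apply ⟨p, hpp⟩)
    obtain ⟨vQ, hvQ⟩ : ∃ vQ : HeightOneSpectrum (𝓞 ℚ), vQ = v := ⟨_, rfl⟩
    have hpvQ : ((p : ℕ) : 𝓞 ℚ) ∈ vQ.asIdeal := by subst hvQ; exact hpv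
    have h2 : natGenerator vQ = p :=
      (Nat.prime_dvd_prime_iff_eq (prime_natGenerator vQ) hpp).mp ((natCast_mem_asIdeal_iff vQ p).mp hpvQ)
    subst hvQ
    rw [h1]
    exact h2
  have hbad : v ∈ badPlacesAvoid (ratPoint q) {2, l} := by
    have hpS : ∀ s ∈ ({2, l} : Finset ℕ), ¬ p ∣ s := by
      intro s hs hps
      simp only [Finset.mem_insert, Finset.mem_singleton] at hs
      rcases hs with rfl | rfl
      · exact hp2 ((Nat.prime_dvd_prime_iff_eq hpp Nat.prime_two).mp hps)
      · exact hpl ((Nat.prime_dvd_prime_iff_eq hpp hl).mp hps)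
    rw [hf]
    exact primesEquiv_symm_mem_badPlacesAvoid_ratPoint hI he hD hj hN {2, l} hpI (hcop p hpI) hpS
  have hldvd := ThetaVolumeDatumAt.l_dvd_ramificationIdx'_of_mem_badPlacesAvoid T v hbad W.asIdeal hWmem
  have hkF : ∀ x : HeightOneSpectrum (𝓞 T.F), ((p : ℕ) : 𝓞 T.F) ∈ x.asIdeal →
      Nat.lcm (30 / Nat.gcd 30 (e p)) (if p = 3 then 2 else if p = 5 then 4 else 1) ∣ x.asIdeal.ramificationIdx ℤ := by
    intro x hx
    refine Nat.lcm_dvd (T.div_gcd_thirty_dvd_ramificationIdx_F hI he hD hj hN hpI (hcop p hpI) x hx) ?_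
    by_cases h3 : p = 3
    · rw [if_pos h3]; subst h3
      exact T.sub_one_dvd_ramificationIdx_int (by norm_num) (by norm_num) x hx
    · rw [if_neg h3]
      by_cases h5 : p = 5
      · rw [if_pos h5]; subst h5
        exact T.sub_one_dvd_ramificationIdx_int (by norm_num) (by norm_num) x hx
      · rw [if_neg h5]; exact one_dvd _
  have hkdvd := T.dvd_ramificationIdx'_ratPoint_of_forall hkF v hpv W.asIdeal hWmem
  have hcop60 : Nat.Coprime (Nat.lcm (30 / Nat.gcd 30 (e p)) (if p = 3 then 2 else if p = 5 then 4 else 1)) l := by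
    have h60 : Nat.lcm (30 / Nat.gcd 30 (e p)) (if p = 3 then 2 else if p = 5 then 4 else 1) ∣ 60 := by
      refine Nat.lcm_dvd ((Nat.div_dvd_of_dvd (Nat.gcd_dvd_left 30 (e p))).trans (by norm_num)) ?_
      split_ifs <;> norm_num
    have hc : Nat.Coprime 60 l := by
      have h2 : Nat.Coprime 2 l := (Nat.coprime_primes Nat.prime_two hl).mpr hl2.symm
      have h3 : Nat.Coprime 3 l := (Nat.coprime_primes (by norm_num) hl).mpr hl3.symm
      have h5 : Nat.Coprime 5 l := (Nat.coprime_primes (by norm_num) hl).mpr hl5.symm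
      have : (60 : ℕ) = 2 * 2 * 3 * 5 := by norm_num
      rw [this]
      exact ((h2.mul_left h2).mul_left h3).mul_left h5
    exact Nat.Coprime.coprime_dvd_left h60 hc
  rw [mul_comm]
  exact hcop60.mul_dvd_of_dvd_of_dvd hkdvd hldvd

end ThetaVolumeDatumAt

/-! ## 3. Bookkeeping: the sharp weight sum in row-normal form (public copy of part 3's private lemma) -/

section Bookkeeping

variable {l : ℕ} {I : Finset ℕ} {e : ℕ → ℕ}

/-- Rearranging the weight sum over `I^{≠2,l} ∪ ({2, l} ∪ ({3, 5} ∖ I))` into the row-normal form. [folklore] -/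
theorem sum_sharpWeights_eq (h7 : 7 ≤ l) (m' : ℕ → ℕ)
    (hmA : ∀ p ∈ I.filter (fun p => p ≠ 2 ∧ p ≠ l),
      m' p = l * Nat.lcm (30 / Nat.gcd 30 (e p)) (if p = 3 then 2 else if p = 5 then 4 else 1))
    (hm2 : m' 2 = 2) (hml : m' l = l - 1) (hm3 : 3 ∉ I → m' 3 = 2) (hm5 : 5 ∉ I → m' 5 = 4) :
    ∑ p ∈ I.filter (fun p => p ≠ 2 ∧ p ≠ l) ∪ ({2, l} ∪ ({3, 5} \ I)),
        (1 - (m' p : ℝ)⁻¹) * Real.log p =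
      (∑ p ∈ I.filter (fun p => p ≠ 2 ∧ p ≠ l),
          (1 - ((l * Nat.lcm (30 / Nat.gcd 30 (e p)) (if p = 3 then 2 else if p = 5 then 4 else 1) : ℕ) : ℝ)⁻¹)
            * Real.log p)
        + 2⁻¹ * Real.log 2
        + (if 3 ∈ I then 0 else 2⁻¹ * Real.log 3)
        + (if 5 ∈ I then 0 else (3 / 4 : ℝ) * Real.log 5)
        + (1 - ((l - 1 : ℕ) : ℝ)⁻¹) * Real.log l := by
  have hl2 : l ≠ 2 := by omega
  have hl3 : l ≠ 3 := by omega
  have hl5 : l ≠ 5 := by omega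
  -- the three pieces are pairwise disjoint
  have hdisjA : Disjoint (I.filter (fun p => p ≠ 2 ∧ p ≠ l)) ({2, l} ∪ ({3, 5} \ I)) := by
    refine Finset.disjoint_left.mpr fun p hpA hpB => ?_
    obtain ⟨hpI, hP⟩ := Finset.mem_filter.mp hpA
    rcases Finset.mem_union.mp hpB with h | h
    · simp only [Finset.mem_insert, Finset.mem_singleton] at h
      omega
    · exact (Finset.mem_sdiff.mp h).2 hpI
  have hdisjB : Disjoint ({2, l} : Finset ℕ) ({3, 5} \ I) := by
    refine Finset.disjoint_left.mpr fun p hp hp' => ?_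
    have h35 := (Finset.mem_sdiff.mp hp').1
    simp only [Finset.mem_insert, Finset.mem_singleton] at hp h35
    omega
  rw [Finset.sum_union hdisjA, Finset.sum_union hdisjB]
  -- piece A
  have hA : ∑ p ∈ I.filter (fun p => p ≠ 2 ∧ p ≠ l), (1 - (m' p : ℝ)⁻¹) * Real.log p =
      ∑ p ∈ I.filter (fun p => p ≠ 2 ∧ p ≠ l),
        (1 - ((l * Nat.lcm (30 / Nat.gcd 30 (e p)) (if p = 3 then 2 else if p = 5 then 4 else 1) : ℕ) : ℝ)⁻¹)
          * Real.log p :=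
    Finset.sum_congr rfl fun p hp => by rw [hmA p hp]
  -- piece B
  have hB : ∑ p ∈ ({2, l} : Finset ℕ), (1 - (m' p : ℝ)⁻¹) * Real.log p =
      2⁻¹ * Real.log 2 + (1 - ((l - 1 : ℕ) : ℝ)⁻¹) * Real.log l := by
    rw [Finset.sum_pair hl2.symm, hm2, hml]
    norm_num
  -- piece C
  have hC : ∑ p ∈ ({3, 5} : Finset ℕ) \ I, (1 - (m' p : ℝ)⁻¹) * Real.log p =
      (if 3 ∈ I then 0 else 2⁻¹ * Real.log 3) + (if 5 ∈ I then 0 else (3 / 4 : ℝ) * Real.log 5) := by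
    rw [Finset.sdiff_eq_filter, Finset.sum_filter, Finset.sum_pair (by norm_num : (3 : ℕ) ≠ 5)]
    congr 1
    · by_cases h3 : 3 ∈ I
      · rw [if_neg (not_not.mpr h3), if_pos h3]
      · rw [if_pos h3, if_neg h3, hm3 h3]; norm_num
    · by_cases h5 : 5 ∈ I
      · rw [if_neg (not_not.mpr h5), if_pos h5]
      · rw [if_pos h5, if_neg h5, hm5 h5]; norm_num
  rw [hA, hB, hC]
  ring

end Bookkeeping

end Literature.IUT.LogVolume.Cor22

end
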